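import Literature.AlgebraicGeometry.Hu2025.Proofs.S03Pluecker.GammaQuadTorusScaleTo
import HarnessLib

/-!
# Hu 2025 / [Hu22] p.131–132 — the TORSOR ISOMORPHISM for the quad cell at ring level:
# `Rh ≅ (Rh ⧸ J)[t₁^±, …, t₈^±]`, i.e. `Gr_d ≅ (Gr_d/(𝔾⁹_m/𝔾_m)) × 𝔾⁸_m`, under which the quotient map `πJ` is the inclusion of
# the slice functions (joint J1 / GAP-LEDGER-HU row HU-R01, reading (β) — kernel support, OURS)

**HONEST FRAMING (D-0012/D-0089).** [Hu2025] (arXiv:2507.21400v1) and [Hu2022] (arXiv:2203.03842v4) are unrefereed preprints under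
adjudication; nothing of them is asserted. OURS objects only (sequel of `GammaQuadTorus` / `GammaQuadTorusInvariance` /
`GammaQuadTorusScaleTo`, typed carriers of rows 101/110).

[Hu22] p.131 l.6–16 («We identify `U` … with the quotient space `Gr_d/(𝔾ⁿ_m/𝔾_m)`. Consider the quotient map `π`») and its gloss
p.132 l.30–51 («`π` … is a principal `(𝔾ⁿ_m/𝔾_m)`-bundle … (9.4) `Gr_d|_O ≅ O × (𝔾ⁿ_m/𝔾_m)` … `(𝔾ⁿ_m/𝔾_m) ≅ 𝔾^{n−1}_m =
Spec 𝔽[s^±_1, ⋯, s^±_{n−1}]`»; res-type-024's field `quot_trivialises` of `Hu22Setup_printed(_ours)`, row 110 g/h). For the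
complete quadrilateral (`n = 9`) THIS FILE proves the GLOBAL trivialisation (one open `O = Gr̄_d`) AT RING LEVEL:
* `LaurentSlice k = (Rh ⧸ J)[t₁, …, t₈][1/∏ tᵢ]` — the coordinate ring of `(Gr_d/T) × 𝔾⁸_m` (slice = `GammaQuadTorus.Slice`);
* `Ψ : Rh → LaurentSlice`, `x̄_u ↦ c_u(σ_t)⁻¹ · x̄_u|_{slice}` (`scaleTo` with the inverse FORMAL torus weights `σ_t` — the
  universal matrix is `σ_t⁻¹ ·` (its normal form)), and `Φ : LaurentSlice → Rh`, slice functions `↦ πJ`, `tᵢ ↦` the eight torus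
  coordinates `A₄₀, A₄₁, A₄₂, A₅₀, …, A₉₀` of `A`;
* `Φ ∘ Ψ = id` (`Φ_comp_Ψ`) and `Ψ ∘ Φ = id` (`Ψ_comp_Φ`), packaged as **`torsorEquiv : Rh k ≃+* LaurentSlice k`**, with
  **`Ψ ∘ πJ = ιL`** (`Ψ_comp_πJ`: under the isomorphism the quotient map `π = Spec πJ` is the projection `(Gr_d/T) × 𝔾⁸_m → Gr_d/T`)
  and `Ψ(tc i) = tᵢ` (the torus coordinates are the Laurent variables).
This is the kernel content of «`π` is the quotient map of the free torus action, globally trivial over the slice»; the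
scheme-level transcription to `splitTorusOver 8` / `quot ∣_ O` of row 110 g/h is NOT done here (said so). AI proof is weaker than
expert review.
-/

noncomputable section

namespace Literature.AlgebraicGeometry.Hu2025.Statements.S03Pluecker

open MvPolynomial Matrix

namespace QuadTorus

open QuadCell

variable (k : Type) [Field k]

/-! ## The Laurent ring over the slice -/

/-- `(Rh ⧸ J)[t₁, …, t₈]`. OURS.
[cite: Hu2025, Thm. 9.4 p.161; [Hu22] p.132 l.43–51 («(9.4) Gr_d|_O ≅ O × (𝔾ⁿ_m/𝔾_m) … 𝔾^{n−1}_m = Spec 𝔽[s^±_1, ⋯, s^±_{n−1}]»); joint J1 = GAP-LEDGER-HU row HU-R01 (unrefereed preprints under adjudication, D-0012/D-0089 — kernel support on OUR typed carriers of rows 101/110; nothing of the sources asserted)] -/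
abbrev SlicePoly : Type := MvPolynomial (Fin 8) (Slice k)

/-- `∏ᵢ tᵢ`. OURS.
[cite: Hu2025, Thm. 9.4 p.161; [Hu22] p.132 l.43–51; joint J1 = GAP-LEDGER-HU row HU-R01 (unrefereed preprints under adjudication, D-0012/D-0089 — kernel support on OUR typed carriers of rows 101/110; nothing of the sources asserted)] -/
def tProd : SlicePoly k := ∏ i : Fin 8, X i

/-- **`LaurentSlice k = (Rh ⧸ J)[t₁^±, …, t₈^±]`** — the coordinate ring of `(Gr_d/(𝔾⁹_m/𝔾_m)) × 𝔾⁸_m` for `d = quad`. OURS.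
[cite: Hu2025, Thm. 9.4 p.161; [Hu22] p.132 l.43–51 («(9.4) Gr_d|_O ≅ O × (𝔾ⁿ_m/𝔾_m) … 𝔾^{n−1}_m = Spec 𝔽[s^±_1, ⋯, s^±_{n−1}]»); joint J1 = GAP-LEDGER-HU row HU-R01 (unrefereed preprints under adjudication, D-0012/D-0089 — kernel support on OUR typed carriers of rows 101/110; nothing of the sources asserted)] -/
abbrev LaurentSlice : Type := Localization.Away (tProd k)

/-- The inclusion of the slice functions `Rh ⧸ J → LaurentSlice` (the projection `(Gr_d/T) × 𝔾⁸_m → Gr_d/T` at ring level). OURS.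
[cite: Hu2025, Thm. 9.4 p.161; [Hu22] p.132 l.43–51; joint J1 = GAP-LEDGER-HU row HU-R01 (unrefereed preprints under adjudication, D-0012/D-0089 — kernel support on OUR typed carriers of rows 101/110; nothing of the sources asserted)] -/
def ιL : Slice k →+* LaurentSlice k := (algebraMap (SlicePoly k) (LaurentSlice k)).comp MvPolynomial.C

/-- `tᵢ` is a unit of the Laurent ring.
[cite: Hu2025, Thm. 9.4 p.161; [Hu22] p.132 l.43–51; joint J1 = GAP-LEDGER-HU row HU-R01 (unrefereed preprints under adjudication, D-0012/D-0089 — kernel support on OUR typed carriers of rows 101/110; nothing of the sources asserted)] -/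
theorem isUnit_tX (i : Fin 8) : IsUnit (algebraMap (SlicePoly k) (LaurentSlice k) (X i)) :=
  isUnit_of_dvd_unit (map_dvd _ (Finset.dvd_prod_of_mem (fun j : Fin 8 => (X j : SlicePoly k)) (Finset.mem_univ i)))
    (IsLocalization.Away.algebraMap_isUnit (tProd k))

/-- **The torus coordinate `tᵢ`** as a unit of `LaurentSlice`. OURS.
[cite: Hu2025, Thm. 9.4 p.161; [Hu22] p.132 l.43–51; joint J1 = GAP-LEDGER-HU row HU-R01 (unrefereed preprints under adjudication, D-0012/D-0089 — kernel support on OUR typed carriers of rows 101/110; nothing of the sources asserted)] -/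
def tX (i : Fin 8) : (LaurentSlice k)ˣ := (isUnit_tX k i).unit

/-- `↑(tX i) = tᵢ`.
[cite: Hu2025, Thm. 9.4 p.161; joint J1 = GAP-LEDGER-HU row HU-R01 (unrefereed preprints under adjudication, D-0012/D-0089 — kernel support on OUR typed carriers of rows 101/110; nothing of the sources asserted)] -/
theorem coe_tX (i : Fin 8) : (tX k i : LaurentSlice k) = algebraMap (SlicePoly k) (LaurentSlice k) (X i) := rfl

/-- **The FORMAL torus element `σ_t`**: the normalising weights `τ` with the eight torus coordinates of `A` replaced by the
Laurent variables (`σ₁ = t₀, σ₂ = t₁, σ₃ = t₂, σ₄ = 1, σ_a = t₀ t_{a−2}⁻¹` for `a = 5..9`). OURS.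
[cite: Hu2025, Thm. 9.4 p.161; [Hu22] p.132 l.43–51; joint J1 = GAP-LEDGER-HU row HU-R01 (unrefereed preprints under adjudication, D-0012/D-0089 — kernel support on OUR typed carriers of rows 101/110; nothing of the sources asserted)] -/
def σB (a : ℕ) : (LaurentSlice k)ˣ :=
  if a = 1 then tX k 0 else if a = 2 then tX k 1 else if a = 3 then tX k 2
  else if h : 5 ≤ a ∧ a ≤ 9 then tX k 0 * (tX k ⟨a - 2, by omega⟩)⁻¹ else 1

/-- The values of `σ_t`.
[cite: Hu2025, Thm. 9.4 p.161; joint J1 = GAP-LEDGER-HU row HU-R01 (unrefereed preprints under adjudication, D-0012/D-0089 — kernel support on OUR typed carriers of rows 101/110; nothing of the sources asserted)] -/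
theorem σB_vals :
    σB k 1 = tX k 0 ∧ σB k 2 = tX k 1 ∧ σB k 3 = tX k 2 ∧ σB k 4 = 1 ∧ σB k 5 = tX k 0 * (tX k 3)⁻¹ ∧
    σB k 6 = tX k 0 * (tX k 4)⁻¹ ∧ σB k 7 = tX k 0 * (tX k 5)⁻¹ ∧ σB k 8 = tX k 0 * (tX k 6)⁻¹ ∧
    σB k 9 = tX k 0 * (tX k 7)⁻¹ := by
  refine ⟨by simp [σB], by simp [σB], by simp [σB], by simp [σB], ?_, ?_, ?_, ?_, ?_⟩ <;>
  · simp only [σB]; rfl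

/-! ## `Ψ : Rh → LaurentSlice` and `Φ : LaurentSlice → Rh` -/

/-- **`Ψ : Rh → (Rh ⧸ J)[t^±]`** — `x̄_u ↦ c_u(σ_t⁻¹) · x̄_u|_{slice}`: the universal matrix is `σ_t⁻¹ ·` (its normal form). OURS.
[cite: Hu2025, Thm. 9.4 p.161; [Hu22] p.131 l.6–16, p.132 l.43–51 ((9.4)); joint J1 = GAP-LEDGER-HU row HU-R01 (unrefereed preprints under adjudication, D-0012/D-0089 — kernel support on OUR typed carriers of rows 101/110; nothing of the sources asserted)] -/
def Ψ : Rh k →+* LaurentSlice k := scaleTo k ((ιL k).comp (Ideal.Quotient.mk (J k))) fun a => (σB k a)⁻¹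

/-- **The eight torus coordinates of `A`**: `A₄₀, A₄₁, A₄₂, A₅₀, A₆₀, A₇₀, A₈₀, A₉₀` (units of `Rh`). OURS.
[cite: Hu2025, Thm. 9.4 («(𝔾ⁿ_m/𝔾_m) acts freely on the matroid Schubert cell») p.161; [Hu22] p.132 l.43–51; joint J1 = GAP-LEDGER-HU row HU-R01 (unrefereed preprints under adjudication, D-0012/D-0089 — kernel support on OUR typed carriers of rows 101/110; nothing of the sources asserted)] -/
def tc (i : Fin 8) : (Rh k)ˣ :=
  match i with
  | 0 => uA k 4 0
  | 1 => uA k 4 1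
  | 2 => uA k 4 2
  | 3 => uA k 5 0
  | 4 => uA k 6 0
  | 5 => uA k 7 0
  | 6 => uA k 8 0
  | 7 => uA k 9 0

/-- `Φ₀ : (Rh ⧸ J)[t] → Rh`, slice functions by `πJ`, `tᵢ ↦ tc i`. OURS.
[cite: Hu2025, Thm. 9.4 p.161; [Hu22] p.132 l.43–51; joint J1 = GAP-LEDGER-HU row HU-R01 (unrefereed preprints under adjudication, D-0012/D-0089 — kernel support on OUR typed carriers of rows 101/110; nothing of the sources asserted)] -/
def Φ₀ : SlicePoly k →+* Rh k := MvPolynomial.eval₂Hom (πJ k) fun i => (tc k i : Rh k)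

/-- `Φ₀ (∏ tᵢ)` is a unit.
[cite: Hu2025, Thm. 9.4 p.161; joint J1 = GAP-LEDGER-HU row HU-R01 (unrefereed preprints under adjudication, D-0012/D-0089 — kernel support on OUR typed carriers of rows 101/110; nothing of the sources asserted)] -/
theorem isUnit_Φ₀_tProd : IsUnit (Φ₀ k (tProd k)) := by
  rw [tProd, map_prod, IsUnit.prod_iff]
  intro i _
  rw [Φ₀, MvPolynomial.eval₂Hom_X']
  exact Units.isUnit _

/-- **`Φ : (Rh ⧸ J)[t^±] → Rh`** — slice functions by `πJ` (the normal form), `tᵢ ↦` the torus coordinates of `A`. OURS.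
[cite: Hu2025, Thm. 9.4 p.161; [Hu22] p.131 l.6–16, p.132 l.43–51 ((9.4)); joint J1 = GAP-LEDGER-HU row HU-R01 (unrefereed preprints under adjudication, D-0012/D-0089 — kernel support on OUR typed carriers of rows 101/110; nothing of the sources asserted)] -/
def Φ : LaurentSlice k →+* Rh k := IsLocalization.Away.lift (tProd k) (isUnit_Φ₀_tProd k)

/-- `Φ` on polynomials.
[cite: Hu2025, Thm. 9.4 p.161; joint J1 = GAP-LEDGER-HU row HU-R01 (unrefereed preprints under adjudication, D-0012/D-0089 — kernel support on OUR typed carriers of rows 101/110; nothing of the sources asserted)] -/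
theorem Φ_algebraMap (p : SlicePoly k) : Φ k (algebraMap (SlicePoly k) (LaurentSlice k) p) = Φ₀ k p :=
  IsLocalization.Away.lift_eq (tProd k) (isUnit_Φ₀_tProd k) p

/-- `Φ ∘ ιL = πJ`.
[cite: Hu2025, Thm. 9.4 p.161; joint J1 = GAP-LEDGER-HU row HU-R01 (unrefereed preprints under adjudication, D-0012/D-0089 — kernel support on OUR typed carriers of rows 101/110; nothing of the sources asserted)] -/
theorem Φ_ιL (y : Slice k) : Φ k (ιL k y) = πJ k y := by
  rw [ιL, RingHom.comp_apply, Φ_algebraMap, Φ₀, MvPolynomial.eval₂Hom_C]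

/-- `Φ (tᵢ) = tc i`.
[cite: Hu2025, Thm. 9.4 p.161; joint J1 = GAP-LEDGER-HU row HU-R01 (unrefereed preprints under adjudication, D-0012/D-0089 — kernel support on OUR typed carriers of rows 101/110; nothing of the sources asserted)] -/
theorem unitsMap_Φ_tX (i : Fin 8) : Units.map (Φ k : LaurentSlice k →* Rh k) (tX k i) = tc k i := by
  apply Units.ext
  rw [Units.coe_map, MonoidHom.coe_coe, coe_tX, Φ_algebraMap, Φ₀, MvPolynomial.eval₂Hom_X']

/-- **`Φ` maps the formal torus element to the normalising one: `Φ (σ_t)_a = τ_a`** (`1 ≤ a ≤ 9`).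
[cite: Hu2025, Thm. 9.4 p.161; [Hu22] p.132 l.43–51; joint J1 = GAP-LEDGER-HU row HU-R01 (unrefereed preprints under adjudication, D-0012/D-0089 — kernel support on OUR typed carriers of rows 101/110; nothing of the sources asserted)] -/
theorem unitsMap_Φ_σB {a : ℕ} (ha1 : 1 ≤ a) (ha9 : a ≤ 9) :
    Units.map (Φ k : LaurentSlice k →* Rh k) (σB k a) = τ k a := by
  obtain ⟨s1, s2, s3, s4, s5, s6, s7, s8, s9⟩ := σB_vals k
  have ha : a = 1 ∨ a = 2 ∨ a = 3 ∨ a = 4 ∨ a = 5 ∨ a = 6 ∨ a = 7 ∨ a = 8 ∨ a = 9 := by omega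
  rcases ha with rfl | rfl | rfl | rfl | rfl | rfl | rfl | rfl | rfl
  · rw [s1, unitsMap_Φ_tX]; simp [τ, tc]
  · rw [s2, unitsMap_Φ_tX]; simp [τ, tc]
  · rw [s3, unitsMap_Φ_tX]; simp [τ, tc]
  · rw [s4, map_one]; simp [τ]
  · rw [s5, map_mul, map_inv, unitsMap_Φ_tX, unitsMap_Φ_tX]; simp [τ, tc]
  · rw [s6, map_mul, map_inv, unitsMap_Φ_tX, unitsMap_Φ_tX]; simp [τ, tc]
  · rw [s7, map_mul, map_inv, unitsMap_Φ_tX, unitsMap_Φ_tX]; simp [τ, tc]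
  · rw [s8, map_mul, map_inv, unitsMap_Φ_tX, unitsMap_Φ_tX]; simp [τ, tc]
  · rw [s9, map_mul, map_inv, unitsMap_Φ_tX, unitsMap_Φ_tX]; simp [τ, tc]

/-- `Φ (c_u(σ_t⁻¹)) = c_u(τ)⁻¹` for chart indices `u`.
[cite: Hu2025, Thm. 9.4 p.161; [Hu22] p.132 l.43–51; joint J1 = GAP-LEDGER-HU row HU-R01 (unrefereed preprints under adjudication, D-0012/D-0089 — kernel support on OUR typed carriers of rows 101/110; nothing of the sources asserted)] -/
theorem unitsMap_Φ_cwB {u : ℕ × ℕ × ℕ} (hu : u ∈ plVarSet 9) :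
    Units.map (Φ k : LaurentSlice k →* Rh k) (cwB (fun a => (σB k a)⁻¹) u) = (cwU k (τ k) u)⁻¹ := by
  have hidx := mem_plIndexSet_iff.mp (Finset.mem_erase.mp hu).2
  simp only [cwB, cwU, map_mul, map_inv]
  rw [unitsMap_Φ_σB k le_rfl (by norm_num), unitsMap_Φ_σB k (by norm_num) (by norm_num),
    unitsMap_Φ_σB k (by norm_num) (by norm_num), unitsMap_Φ_σB k (a := u.1) (by omega) (by omega),
    unitsMap_Φ_σB k (a := u.2.1) (by omega) (by omega), unitsMap_Φ_σB k (a := u.2.2) (by omega) (by omega)]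
  apply Additive.ofMul.injective
  simp only [ofMul_mul, ofMul_inv, _root_.mul_inv_rev]
  abel

/-- **`Φ ∘ Ψ = id` on `Rh`** (the torus orbit map followed by the normal form and torus coordinates recovers the matrix).
[cite: Hu2025, Thm. 9.4 p.161; [Hu22] p.131 l.6–16, p.132 l.43–51 ((9.4) «Gr_d|_O ≅ O × (𝔾ⁿ_m/𝔾_m)»); joint J1 = GAP-LEDGER-HU row HU-R01 (unrefereed preprints under adjudication, D-0012/D-0089 — kernel support on OUR typed carriers of rows 101/110; nothing of the sources asserted)] -/
theorem Φ_comp_Ψ : (Φ k).comp (Ψ k) = RingHom.id (Rh k) := by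
  apply IsLocalization.ringHom_ext (Submonoid.powers (hq k))
  apply Ideal.Quotient.ringHom_ext
  refine MvPolynomial.ringHom_ext (fun c => ?_) (fun x => ?_)
  · simp only [RingHom.comp_apply, RingHom.id_apply]
    have h1 := scaleTo_toRh_C k ((ιL k).comp (Ideal.Quotient.mk (J k))) (fun a => (σB k a)⁻¹) c
    have h2 := scale_toRh_C k (τ k) c
    rw [toRh, RingHom.comp_apply] at h1 h2
    rw [Ψ, h1, RingHom.comp_apply, Φ_ιL, πJ_mk, ν, h2]
  · simp only [RingHom.comp_apply, RingHom.id_apply]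
    obtain ⟨t, ht⟩ := x
    have e : (X ⟨t, ht⟩ : ChartRing 9 k) = xbar k t := (xbar_of_mem k ht).symm
    have hm : (algebraMap (Rq k) (Rh k)) (Ideal.Quotient.mk (gammaChartIdeal k 9 quadGamma) (X ⟨t, ht⟩)) = m k t := by
      rw [e]; rfl
    rw [hm, Ψ, scaleTo_m k _ _ ht, map_mul, RingHom.comp_apply, Φ_ιL, πJ_mk, ν, scale_m k (τ k) ht, ← coe_cwU]
    have hu := congrArg Units.val (unitsMap_Φ_cwB k ht)
    rw [Units.coe_map, MonoidHom.coe_coe] at hu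
    rw [hu, ← mul_assoc, Units.inv_mul, one_mul]

/-! ## `Ψ ∘ Φ = id`: the images of the torus coordinates and of the normalising weights -/

/-- Row weights of the inverse family: `r_i(σ_t⁻¹) = (σ_t)_{i+1}`.
[cite: Hu2025, Thm. 9.4 p.161; joint J1 = GAP-LEDGER-HU row HU-R01 (unrefereed preprints under adjudication, D-0012/D-0089 — kernel support on OUR typed carriers of rows 101/110; nothing of the sources asserted)] -/
theorem rwB_inv (i : Fin 3) : rwB (fun a => (σB k a)⁻¹) i = σB k (i.val + 1) := by
  fin_cases i <;> simp [rwB]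

/-- **`Ψ` on the slice-generator units**: `Ψ (A_{a,i}) = (σ_t)_{i+1} (σ_t)_a⁻¹` whenever `A_{a,i} ≡ 1` modulo `J`.
[cite: Hu2025, Thm. 9.4 p.161; [Hu22] p.132 l.43–51; joint J1 = GAP-LEDGER-HU row HU-R01 (unrefereed preprints under adjudication, D-0012/D-0089 — kernel support on OUR typed carriers of rows 101/110; nothing of the sources asserted)] -/
theorem unitsMap_Ψ_uA {a : ℕ} (ha : 3 < a) (ha9 : a ≤ 9) (i : Fin 3)
    (hmk : Ideal.Quotient.mk (J k) (A k a i) = 1) :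
    Units.map (Ψ k : Rh k →* LaurentSlice k) (uA k a i) = σB k (i.val + 1) * (σB k a)⁻¹ := by
  apply Units.ext
  rw [Units.coe_map, MonoidHom.coe_coe, coe_uA k ha ha9, Ψ, scaleTo_A k _ _ (by omega) ha9, RingHom.comp_apply, hmk, map_one,
    mul_one, Units.val_mul, ← rwB_inv]

/-- **`Ψ` maps the normalising torus element to the formal one: `Ψ (τ_a) = (σ_t)_a`** (`1 ≤ a ≤ 9`).
[cite: Hu2025, Thm. 9.4 p.161; [Hu22] p.132 l.43–51; joint J1 = GAP-LEDGER-HU row HU-R01 (unrefereed preprints under adjudication, D-0012/D-0089 — kernel support on OUR typed carriers of rows 101/110; nothing of the sources asserted)] -/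
theorem unitsMap_Ψ_τ {a : ℕ} (ha1 : 1 ≤ a) (ha9 : a ≤ 9) :
    Units.map (Ψ k : Rh k →* LaurentSlice k) (τ k a) = σB k a := by
  obtain ⟨g0, g4⟩ := mk_A_eq_one k
  obtain ⟨s1, s2, s3, s4, s5, s6, s7, s8, s9⟩ := σB_vals k
  have h4 : ∀ i : Fin 3, Units.map (Ψ k : Rh k →* LaurentSlice k) (uA k 4 i) = σB k (i.val + 1) * (σB k 4)⁻¹ :=
    fun i => unitsMap_Ψ_uA k (by norm_num) (by norm_num) i (g4 i)
  by_cases ha : 4 ≤ a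
  · have e : τ k a = uA k 4 0 * (uA k a 0)⁻¹ := by
      unfold τ; rw [if_neg (by omega), if_neg (by omega), if_neg (by omega), if_pos ⟨ha, ha9⟩]
    rw [e, map_mul, map_inv, h4 0, unitsMap_Ψ_uA k (by omega) ha9 0 (g0 a (by omega) ha9), s4, inv_one, mul_one]
    apply Additive.ofMul.injective
    simp only [ofMul_mul, ofMul_inv, Fin.val_zero]
    abel
  · have ha' : a = 1 ∨ a = 2 ∨ a = 3 := by omega
    rcases ha' with rfl | rfl | rfl
    · have e : τ k 1 = uA k 4 0 := by simp [τ]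
      rw [e, h4 0, s4]; simp
    · have e : τ k 2 = uA k 4 1 := by simp [τ]
      rw [e, h4 1, s4]; simp
    · have e : τ k 3 = uA k 4 2 := by simp [τ]
      rw [e, h4 2, s4]; simp

/-- `Ψ (c_u(τ)) · c_u(σ_t⁻¹) = 1` for chart indices `u`.
[cite: Hu2025, Thm. 9.4 p.161; [Hu22] p.132 l.43–51; joint J1 = GAP-LEDGER-HU row HU-R01 (unrefereed preprints under adjudication, D-0012/D-0089 — kernel support on OUR typed carriers of rows 101/110; nothing of the sources asserted)] -/
theorem unitsMap_Ψ_cwU {u : ℕ × ℕ × ℕ} (hu : u ∈ plVarSet 9) :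
    Units.map (Ψ k : Rh k →* LaurentSlice k) (cwU k (τ k) u) * cwB (fun a => (σB k a)⁻¹) u = 1 := by
  have hidx := mem_plIndexSet_iff.mp (Finset.mem_erase.mp hu).2
  simp only [cwB, cwU, map_mul, map_inv]
  rw [unitsMap_Ψ_τ k le_rfl (by norm_num), unitsMap_Ψ_τ k (by norm_num) (by norm_num),
    unitsMap_Ψ_τ k (by norm_num) (by norm_num), unitsMap_Ψ_τ k (a := u.1) (by omega) (by omega),
    unitsMap_Ψ_τ k (a := u.2.1) (by omega) (by omega), unitsMap_Ψ_τ k (a := u.2.2) (by omega) (by omega)]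
  apply Additive.ofMul.injective
  simp only [ofMul_mul, ofMul_inv, ofMul_one]
  abel

/-- **`Ψ ∘ πJ = ιL`**: under `Ψ` the quotient map becomes the inclusion of the slice functions — the projection
`(Gr_d/T) × 𝔾⁸_m → Gr_d/T` («`e.hom ≫ proj = quot`» of row 110 g/h at ring level).
[cite: Hu2025, Thm. 9.4 p.161; [Hu22] p.131 l.10–16 («the quotient map π»), p.132 l.43–51 ((9.4)); joint J1 = GAP-LEDGER-HU row HU-R01 (unrefereed preprints under adjudication, D-0012/D-0089 — kernel support on OUR typed carriers of rows 101/110; nothing of the sources asserted)] -/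
theorem Ψ_comp_πJ : (Ψ k).comp (πJ k) = ιL k := by
  apply Ideal.Quotient.ringHom_ext
  rw [RingHom.comp_assoc, πJ, Ideal.Quotient.lift_comp_mk]
  apply IsLocalization.ringHom_ext (Submonoid.powers (hq k))
  apply Ideal.Quotient.ringHom_ext
  refine MvPolynomial.ringHom_ext (fun c => ?_) (fun x => ?_)
  · simp only [RingHom.comp_apply]
    have h1 := scaleTo_toRh_C k ((ιL k).comp (Ideal.Quotient.mk (J k))) (fun a => (σB k a)⁻¹) c
    have h2 := scale_toRh_C k (τ k) c
    rw [toRh, RingHom.comp_apply] at h1 h2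
    rw [ν, h2, Ψ, h1, RingHom.comp_apply]
  · simp only [RingHom.comp_apply]
    obtain ⟨t, ht⟩ := x
    have e : (X ⟨t, ht⟩ : ChartRing 9 k) = xbar k t := (xbar_of_mem k ht).symm
    have hm : (algebraMap (Rq k) (Rh k)) (Ideal.Quotient.mk (gammaChartIdeal k 9 quadGamma) (X ⟨t, ht⟩)) = m k t := by
      rw [e]; rfl
    rw [hm, ν, scale_m k (τ k) ht, ← coe_cwU, map_mul, Ψ, scaleTo_m k _ _ ht, ← Ψ, ← mul_assoc, RingHom.comp_apply]
    have hu := congrArg Units.val (unitsMap_Ψ_cwU k ht)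
    rw [Units.val_mul, Units.coe_map, MonoidHom.coe_coe, Units.val_one] at hu
    rw [hu, one_mul]

/-- `Ψ (tc i) = tᵢ`: the torus coordinates of `A` are the Laurent variables.
[cite: Hu2025, Thm. 9.4 p.161; [Hu22] p.132 l.43–51; joint J1 = GAP-LEDGER-HU row HU-R01 (unrefereed preprints under adjudication, D-0012/D-0089 — kernel support on OUR typed carriers of rows 101/110; nothing of the sources asserted)] -/
theorem unitsMap_Ψ_tc (i : Fin 8) : Units.map (Ψ k : Rh k →* LaurentSlice k) (tc k i) = tX k i := by
  obtain ⟨g0, g4⟩ := mk_A_eq_one k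
  obtain ⟨s1, s2, s3, s4, s5, s6, s7, s8, s9⟩ := σB_vals k
  fin_cases i
  · show Units.map (Ψ k : Rh k →* LaurentSlice k) (uA k 4 0) = tX k 0
    rw [unitsMap_Ψ_uA k (by norm_num) (by norm_num) 0 (g4 0), s4]; simp [s1]
  · show Units.map (Ψ k : Rh k →* LaurentSlice k) (uA k 4 1) = tX k 1
    rw [unitsMap_Ψ_uA k (by norm_num) (by norm_num) 1 (g4 1), s4]; simp [s2]
  · show Units.map (Ψ k : Rh k →* LaurentSlice k) (uA k 4 2) = tX k 2
    rw [unitsMap_Ψ_uA k (by norm_num) (by norm_num) 2 (g4 2), s4]; simp [s3]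
  · show Units.map (Ψ k : Rh k →* LaurentSlice k) (uA k 5 0) = tX k 3
    rw [unitsMap_Ψ_uA k (by norm_num) (by norm_num) 0 (g0 5 (by norm_num) (by norm_num))]
    simp [s1, s5]
  · show Units.map (Ψ k : Rh k →* LaurentSlice k) (uA k 6 0) = tX k 4
    rw [unitsMap_Ψ_uA k (by norm_num) (by norm_num) 0 (g0 6 (by norm_num) (by norm_num))]
    simp [s1, s6]
  · show Units.map (Ψ k : Rh k →* LaurentSlice k) (uA k 7 0) = tX k 5
    rw [unitsMap_Ψ_uA k (by norm_num) (by norm_num) 0 (g0 7 (by norm_num) (by norm_num))]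
    simp [s1, s7]
  · show Units.map (Ψ k : Rh k →* LaurentSlice k) (uA k 8 0) = tX k 6
    rw [unitsMap_Ψ_uA k (by norm_num) (by norm_num) 0 (g0 8 (by norm_num) (by norm_num))]
    simp [s1, s8]
  · show Units.map (Ψ k : Rh k →* LaurentSlice k) (uA k 9 0) = tX k 7
    rw [unitsMap_Ψ_uA k (by norm_num) (by norm_num) 0 (g0 9 (by norm_num) (by norm_num))]
    simp [s1, s9]

/-- **`Ψ ∘ Φ = id` on `LaurentSlice`.**
[cite: Hu2025, Thm. 9.4 p.161; [Hu22] p.131 l.6–16, p.132 l.43–51 ((9.4)); joint J1 = GAP-LEDGER-HU row HU-R01 (unrefereed preprints under adjudication, D-0012/D-0089 — kernel support on OUR typed carriers of rows 101/110; nothing of the sources asserted)] -/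
theorem Ψ_comp_Φ : (Ψ k).comp (Φ k) = RingHom.id (LaurentSlice k) := by
  apply IsLocalization.ringHom_ext (Submonoid.powers (tProd k))
  refine MvPolynomial.ringHom_ext (fun y => ?_) (fun i => ?_)
  · simp only [RingHom.comp_apply, RingHom.id_apply]
    have h := congrFun (congrArg DFunLike.coe (Ψ_comp_πJ k)) y
    rw [RingHom.comp_apply] at h
    rw [← MvPolynomial.algebraMap_eq]
    show Ψ k (Φ k (ιL k y)) = ιL k y
    rw [Φ_ιL, h]
  · simp only [RingHom.comp_apply, RingHom.id_apply]
    have h := congrArg Units.val (unitsMap_Ψ_tc k i)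
    have h' := congrArg Units.val (unitsMap_Φ_tX k i)
    rw [Units.coe_map, MonoidHom.coe_coe] at h h'
    rw [← coe_tX, h', h]

/-- **MAIN (W11e): the TORSOR ISOMORPHISM `Rh ≅ (Rh ⧸ J)[t₁^±, …, t₈^±]`** — `Gr_d ≅ (Gr_d/(𝔾⁹_m/𝔾_m)) × 𝔾⁸_m` at ring level
for the complete quadrilateral: the free torus action has the global slice `Spec (Rh ⧸ J)`, the quotient map `π = Spec πJ` is the
projection (`Ψ_comp_πJ`) and the torus coordinates are `A₄₀, A₄₁, A₄₂, A₅₀, …, A₉₀` (`unitsMap_Ψ_tc`). This is (9.4) of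
[Hu22] p.132 with ONE open for `d = quad`, OURS and at ring level; nothing of [Hu25]/[Hu22] asserted.
[cite: Hu2025, Thm. 9.4 («U is isomorphic to the quotient space Gr̄_d := Gr_d/(𝔾ⁿ_m/𝔾_m)») p.161; [Hu22] p.131 l.6–16, p.132 l.30–51 («π … is a principal (𝔾ⁿ_m/𝔾_m)-bundle … (9.4) Gr_d|_O ≅ O × (𝔾ⁿ_m/𝔾_m)»); joint J1 = GAP-LEDGER-HU row HU-R01 (unrefereed preprints under adjudication, D-0012/D-0089 — kernel support on OUR typed carriers of rows 101/110; nothing of the sources asserted)] -/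
def torsorEquiv : Rh k ≃+* LaurentSlice k :=
  RingEquiv.ofRingHom (Ψ k) (Φ k) (Ψ_comp_Φ k) (Φ_comp_Ψ k)

/-- `torsorEquiv` is `Ψ`.
[cite: Hu2025, Thm. 9.4 p.161; [Hu22] p.132 l.43–51; joint J1 = GAP-LEDGER-HU row HU-R01 (unrefereed preprints under adjudication, D-0012/D-0089 — kernel support on OUR typed carriers of rows 101/110; nothing of the sources asserted)] -/
theorem torsorEquiv_apply (x : Rh k) : torsorEquiv k x = Ψ k x := rfl

/-- **Compatibility with the quotient map**: `torsorEquiv (πJ y) = ιL y`.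
[cite: Hu2025, Thm. 9.4 p.161; [Hu22] p.131 l.10–16, p.132 l.43–51; joint J1 = GAP-LEDGER-HU row HU-R01 (unrefereed preprints under adjudication, D-0012/D-0089 — kernel support on OUR typed carriers of rows 101/110; nothing of the sources asserted)] -/
theorem torsorEquiv_πJ (y : Slice k) : torsorEquiv k (πJ k y) = ιL k y := by
  rw [torsorEquiv_apply, ← RingHom.comp_apply, Ψ_comp_πJ]

end QuadTorus

end Literature.AlgebraicGeometry.Hu2025.Statements.S03Pluecker

end
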